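import Summits.Ventures.PercRepro.RankLevelSetExplicitLin2ArithB2

/-!
# PercRepro — THE PER-CORANK CELL MAP OF THEOREM P⁗″, THE ARITHMETIC: a core cell `(p, d)` at level `q ≥ 8` with
`d ≥ q + 2` closes for `p ≥ max(320q, 3(q+5)d, 3q·k·2^{⌈q/2⌉})`, `d + 2 ≤ k²`, `3k² ≤ 2^q` (p9, S4)

`proofs/SUBCLAIM-S4-p9.md` §S4.3⁗. THEOREM P⁗″'s nine term conditions hold at the UNIFORM `p ≥ q·2^{q+1}`; at a FIXED
corank `d` with `3(d+2) ≤ 2^q` (both weights at their cap `W·d ≤ 2^d`, no local sparsity needed) the same five conditions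
need only `p ≥ 320q` (`(C1)`), `p ≥ 3(q+5)d` (the big class: `16·2^q·((q+5)d)^q ≤ d·(3(q+5)d)^q` as `16·2^q ≤ 3^q·d`),
and `p ≥ 3q·k·2^{⌈q/2⌉}` with `d + 2 ≤ k²` (the small class, whose binding term scales as `√d`) — POLYNOMIAL in `d`,
against the cell's earlier map `Tcell(q, d)` (§S4.3″), exponential in `d`. This file: the threshold `Tcell2`, the five
term bounds and the assembled `(P_d)` (`poly_cells`). Axioms: standard.
-/

namespace PercRepro

namespace ThmN

namespace Explicit

/-- **THE PER-CORANK THRESHOLD**: `Tcell2 q d k = max (max (320·q) (3·(q+5)·d)) (3·q·k·2^{(q+1)/2})` (`k` with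
`d + 2 ≤ k²`; `(q+1)/2 = ⌈q/2⌉` in `ℕ`). -/
def Tcell2 (q d k : ℕ) : ℕ := max (max (320 * q) (3 * (q + 5) * d)) (3 * q * k * 2 ^ ((q + 1) / 2))

/-- The facts from `Tcell2 q d k ≤ p`: `320q ≤ p`, `3(q+5)d ≤ p`, `3qk·2^{⌈q/2⌉} ≤ p`, and
`9q²k²·2^q ≤ p²`, `27q³k³·2^{3q/2}`-type powers via `2^{2⌈q/2⌉} ≥ 2^q`. -/
theorem Tcell2_facts (q d k p : ℕ) (hp : Tcell2 q d k ≤ p) :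
    320 * q ≤ p ∧ 3 * (q + 5) * d ≤ p ∧ 3 * q * k * 2 ^ ((q + 1) / 2) ≤ p ∧
      9 * q ^ 2 * k ^ 2 * 2 ^ q ≤ p ^ 2 := by
  unfold Tcell2 at hp
  have h1 : 320 * q ≤ p := le_trans (le_max_left _ _) (le_trans (le_max_left _ _) hp)
  have h2 : 3 * (q + 5) * d ≤ p := le_trans (le_max_right _ _) (le_trans (le_max_left _ _) hp)
  have h3 : 3 * q * k * 2 ^ ((q + 1) / 2) ≤ p := le_trans (le_max_right _ _) hp
  refine ⟨h1, h2, h3, ?_⟩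
  have h4 : 2 ^ q ≤ 2 ^ ((q + 1) / 2) * 2 ^ ((q + 1) / 2) := by
    rw [← pow_add]; exact Nat.pow_le_pow_right (by norm_num) (by omega)
  calc 9 * q ^ 2 * k ^ 2 * 2 ^ q ≤ 9 * q ^ 2 * k ^ 2 * (2 ^ ((q + 1) / 2) * 2 ^ ((q + 1) / 2)) :=
        Nat.mul_le_mul_left _ h4
    _ = (3 * q * k * 2 ^ ((q + 1) / 2)) ^ 2 := by ring
    _ ≤ p ^ 2 := Nat.pow_le_pow_left h3 2

/-- **(C1) per corank**: `64·C(p+d, q) ≤ (64 + 2^{d−q})·C(p+q, q)` for `q ≥ 8`, `q + 1 ≤ d`, `p ≥ 320q`,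
`p ≥ 3(q+5)d`. -/
theorem c1_cell (q d p : ℕ) (hq : 8 ≤ q) (hd1 : q + 1 ≤ d) (h1 : 320 * q ≤ p)
    (h2 : 3 * (q + 5) * d ≤ p) :
    64 * (p + d).choose q ≤ (64 + 2 ^ (d - q)) * (p + q).choose q := by
  set m := d - q with hm
  have hmq : 2 * q * m ≤ p + 1 := by
    have hmd : 2 * q * m ≤ 2 * q * d := Nat.mul_le_mul_left _ (by omega)
    have : 2 * q * d ≤ 3 * (q + 5) * d := Nat.mul_le_mul_right _ (by omega)
    omega
  have hR := choose_mul_pow_le_choose_mul_pow p q d (by omega)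
  have hB := add_pow_mul_le_pow_mul (p + 1) m q hmq
  have hpos : 0 < (p + 1) ^ q := by positivity
  have hc : (p + d).choose q * (p + 1) ≤ (p + q).choose q * (p + 1 + 2 * q * m) := by
    apply Nat.le_of_mul_le_mul_right _ hpos
    calc (p + d).choose q * (p + 1) * (p + 1) ^ q = (p + d).choose q * (p + 1) ^ q * (p + 1) := by ring
      _ ≤ (p + q).choose q * (p + 1 + m) ^ q * (p + 1) := Nat.mul_le_mul_right _ hR
      _ = (p + q).choose q * ((p + 1 + m) ^ q * (p + 1)) := by ring
      _ ≤ (p + q).choose q * ((p + 1) ^ q * (p + 1 + 2 * q * m)) := Nat.mul_le_mul_left _ hB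
      _ = (p + q).choose q * (p + 1 + 2 * q * m) * (p + 1) ^ q := by ring
  -- `128·q·m ≤ 2^m·(p+1)`: `m ≤ 5`: `128·q·m ≤ 640q ≤ 2(p+1) ≤ 2^m(p+1)`; `m ≥ 6`: `2^m ≥ 64` and `2qm ≤ p+1`
  have h2 : 128 * q * m ≤ 2 ^ m * (p + 1) := by
    rcases Nat.lt_or_ge m 6 with hm6 | hm6
    · have : 2 ≤ 2 ^ m := by
        calc 2 = 2 ^ 1 := by norm_num
          _ ≤ 2 ^ m := Nat.pow_le_pow_right (by norm_num) (by omega)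
      calc 128 * q * m ≤ 128 * q * 5 := by gcongr; omega
        _ = 2 * (320 * q) := by ring
        _ ≤ 2 * (p + 1) := by omega
        _ ≤ 2 ^ m * (p + 1) := Nat.mul_le_mul_right _ this
    · have h64 : 64 ≤ 2 ^ m := by
        calc 64 = 2 ^ 6 := by norm_num
          _ ≤ 2 ^ m := Nat.pow_le_pow_right (by norm_num) hm6
      calc 128 * q * m = 64 * (2 * q * m) := by ring
        _ ≤ 2 ^ m * (p + 1) := Nat.mul_le_mul h64 hmq
  have hp1 : 0 < p + 1 := by omega
  apply Nat.le_of_mul_le_mul_right _ hp1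
  calc 64 * (p + d).choose q * (p + 1) = 64 * ((p + d).choose q * (p + 1)) := by ring
    _ ≤ 64 * ((p + q).choose q * (p + 1 + 2 * q * m)) := Nat.mul_le_mul_left _ hc
    _ = 64 * (p + q).choose q * (p + 1) + (p + q).choose q * (128 * q * m) := by ring
    _ ≤ 64 * (p + q).choose q * (p + 1) + (p + q).choose q * (2 ^ m * (p + 1)) :=
        Nat.add_le_add_left (Nat.mul_le_mul_left _ h2) _
    _ = (64 + 2 ^ m) * (p + q).choose q * (p + 1) := by ring

/-- The ratio bounds per corank (they need only `2qd ≤ p + 3`, `(q−4)(3d+q−6) ≤ 2(p+5)`): `C(p+d, q−2) ≤ 2C(p+q, q−2)`,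
`C(p+d, q−3) ≤ 2C(p+q, q−3)`, `C(2d+2q−6+(p+d), q−4) ≤ 8C(p+q, q−4)`, `24·C(2d+2q−2, 4) ≤ 256d^4`. -/
theorem cell_ratios (q d p : ℕ) (hq : 8 ≤ q) (hd1 : q + 1 ≤ d) (h2 : 3 * (q + 5) * d ≤ p) :
    (p + d).choose (q - 2) ≤ 2 * (p + q).choose (q - 2) ∧ (p + d).choose (q - 3) ≤ 2 * (p + q).choose (q - 3) ∧
      (2 * d + 2 * q - 6 + (p + d)).choose (q - 4) ≤ 8 * (p + q).choose (q - 4) ∧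
      24 * (2 * d + 2 * q - 2).choose 4 ≤ 256 * d ^ 4 := by
  refine ⟨?_, ?_, ?_, ?_⟩
  · have h := choose_le_two_mul_choose (q - 2) (d - q - 1) (p + 2) (by
      have : 2 * (q - 2) * (d - q - 1 + 1) ≤ 3 * (q + 5) * d :=
        Nat.mul_le_mul (by omega) (by omega)
      omega)
    rwa [show p + 2 + (q - 2) + 1 + (d - q - 1) = p + d by omega, show p + 2 + (q - 2) = p + q by omega] at h
  · have h := choose_le_two_mul_choose (q - 3) (d - q - 1) (p + 3) (by
      have : 2 * (q - 3) * (d - q - 1 + 1) ≤ 3 * (q + 5) * d :=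
        Nat.mul_le_mul (by omega) (by omega)
      omega)
    rwa [show p + 3 + (q - 3) + 1 + (d - q - 1) = p + d by omega, show p + 3 + (q - 3) = p + q by omega] at h
  · have h := choose_le_eight_mul_choose (q - 4) (3 * d + q - 7) (p + 4) (by
      -- `(q−4)(3d + q − 6) ≤ q·(3d + q) ≤ 2·3(q+5)d ≤ 2(p+5)`
      have h1 : (q - 4) * (3 * d + q - 7 + 1) ≤ q * (3 * d + q) := Nat.mul_le_mul (by omega) (by omega)
      have h2' : q * (3 * d + q) ≤ 2 * (3 * (q + 5) * d) := by nlinarith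
      omega)
    rwa [show p + 4 + (q - 4) + 1 + (3 * d + q - 7) = 2 * d + 2 * q - 6 + (p + d) by omega,
      show p + 4 + (q - 4) = p + q by omega] at h
  · have h := twentyfour_mul_choose_four_le (2 * d + 2 * q - 2)
    have h4 : (2 * d + 2 * q - 2) ^ 4 ≤ (4 * d) ^ 4 := Nat.pow_le_pow_left (by omega) 4
    calc 24 * (2 * d + 2 * q - 2).choose 4 ≤ (2 * d + 2 * q - 2) ^ 4 := h
      _ ≤ (4 * d) ^ 4 := h4
      _ = 256 * d ^ 4 := by ring

/-- `16·2^q ≤ 3^q` for `q ≥ 7` (the big class per corank). -/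
theorem sixteen_two_pow_le_three_pow (q : ℕ) (hq : 7 ≤ q) : 16 * 2 ^ q ≤ 3 ^ q := by
  induction q, hq using Nat.le_induction with
  | base => norm_num
  | succ q hq ih =>
    rw [pow_succ, pow_succ]
    calc 16 * (2 ^ q * 2) = 2 * (16 * 2 ^ q) := by ring
      _ ≤ 2 * 3 ^ q := by omega
      _ ≤ 3 ^ q * 3 := by omega

/-- **(S3) per corank**: `24·2^q·d(d+1)·C(p+d, q−2) ≤ 7·d·C(p+q, q)` for `d + 2 ≤ k²`, `9q²k²·2^q ≤ p²`. -/
theorem small_three_cell (q d p k : ℕ) (hq : 8 ≤ q) (hd1 : q + 1 ≤ d) (h2 : 3 * (q + 5) * d ≤ p)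
    (hk : d + 2 ≤ k ^ 2) (hp2 : 9 * q ^ 2 * k ^ 2 * 2 ^ q ≤ p ^ 2) :
    24 * 2 ^ q * (d * (d + 1)) * (p + d).choose (q - 2) ≤ 7 * d * (p + q).choose q := by
  obtain ⟨hr, -, -, -⟩ := cell_ratios q d p hq hd1 h2
  obtain ⟨hdown, -, -⟩ := levels_down2 p q (by omega)
  have hkey : 48 * 2 ^ q * (d * (d + 1)) * q ^ 2 ≤ 7 * d * p ^ 2 := by
    have h1 : 48 * 2 ^ q * (d * (d + 1)) * q ^ 2 ≤ 48 * 2 ^ q * (d * k ^ 2) * q ^ 2 := by gcongr; omega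
    have h9 : 9 * (48 * 2 ^ q * (d * k ^ 2) * q ^ 2) ≤ 9 * (7 * d * p ^ 2) := by
      calc 9 * (48 * 2 ^ q * (d * k ^ 2) * q ^ 2) = 48 * d * (9 * q ^ 2 * k ^ 2 * 2 ^ q) := by ring
        _ ≤ 48 * d * p ^ 2 := Nat.mul_le_mul_left _ hp2
        _ ≤ 63 * d * p ^ 2 := by nlinarith
        _ = 9 * (7 * d * p ^ 2) := by ring
    exact h1.trans (Nat.le_of_mul_le_mul_left h9 (by norm_num))
  have hp0 : 0 < p := lt_of_lt_of_le (Nat.mul_pos (Nat.mul_pos (by norm_num) (by omega)) (by omega)) h2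
  have hpos : 0 < p ^ 2 := pow_pos hp0 2
  apply Nat.le_of_mul_le_mul_right _ hpos
  calc 24 * 2 ^ q * (d * (d + 1)) * (p + d).choose (q - 2) * p ^ 2
      ≤ 24 * 2 ^ q * (d * (d + 1)) * (2 * (p + q).choose (q - 2)) * p ^ 2 := by gcongr
    _ = 48 * 2 ^ q * (d * (d + 1)) * (p ^ 2 * (p + q).choose (q - 2)) := by ring
    _ ≤ 48 * 2 ^ q * (d * (d + 1)) * (q ^ 2 * (p + q).choose q) := Nat.mul_le_mul_left _ hdown
    _ = (48 * 2 ^ q * (d * (d + 1)) * q ^ 2) * (p + q).choose q := by ring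
    _ ≤ (7 * d * p ^ 2) * (p + q).choose q := Nat.mul_le_mul_right _ hkey
    _ = 7 * d * (p + q).choose q * p ^ 2 := by ring

/-- The powers of `p ≥ 3qk·2^{⌈q/2⌉}` with `3k² ≤ 2^q`: `64·k ≤ 81·2^{⌈q/2⌉}` and the cubes / fourth powers
`27q³k³·2^q·2^{⌈q/2⌉} ≤ p³`, `81q⁴k⁴·(2^q)² ≤ p⁴`. -/
theorem cell_powers (q k p : ℕ) (h3 : 3 * q * k * 2 ^ ((q + 1) / 2) ≤ p) (hk3 : 3 * k ^ 2 ≤ 2 ^ q) :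
    k ≤ 2 ^ ((q + 1) / 2) ∧ 27 * q ^ 3 * k ^ 3 * 2 ^ q * 2 ^ ((q + 1) / 2) ≤ p ^ 3 ∧
      81 * q ^ 4 * k ^ 4 * (2 ^ q) ^ 2 ≤ p ^ 4 := by
  set c := 2 ^ ((q + 1) / 2) with hc
  have hcq : 2 ^ q ≤ c * c := by
    rw [hc, ← pow_add]; exact Nat.pow_le_pow_right (by norm_num) (by omega)
  have hkc : k ≤ c := by
    by_contra h
    push Not at h
    have : c * c < k * k := Nat.mul_lt_mul'' h h
    nlinarith
  refine ⟨hkc, ?_, ?_⟩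
  · calc 27 * q ^ 3 * k ^ 3 * 2 ^ q * c ≤ 27 * q ^ 3 * k ^ 3 * (c * c) * c := by gcongr
      _ = (3 * q * k * c) ^ 3 := by ring
      _ ≤ p ^ 3 := Nat.pow_le_pow_left h3 3
  · calc 81 * q ^ 4 * k ^ 4 * (2 ^ q) ^ 2 ≤ 81 * q ^ 4 * k ^ 4 * (c * c) ^ 2 := by gcongr
      _ = (3 * q * k * c) ^ 4 := by ring
      _ ≤ p ^ 4 := Nat.pow_le_pow_left h3 4

/-- **(S4) per corank**: `32·2^q·d(d+1)(d+2)·C(p+d, q−3) ≤ 3·d·C(p+q, q)`. -/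
theorem small_four_cell (q d p k : ℕ) (hq : 8 ≤ q) (hd1 : q + 1 ≤ d) (h2 : 3 * (q + 5) * d ≤ p)
    (hk : d + 2 ≤ k ^ 2) (hk3 : 3 * k ^ 2 ≤ 2 ^ q) (h3 : 3 * q * k * 2 ^ ((q + 1) / 2) ≤ p) :
    32 * 2 ^ q * (d * (d + 1) * (d + 2)) * (p + d).choose (q - 3) ≤ 3 * d * (p + q).choose q := by
  obtain ⟨-, hr, -, -⟩ := cell_ratios q d p hq hd1 h2
  obtain ⟨-, hdown, -⟩ := levels_down2 p q (by omega)
  obtain ⟨hkc, hp3, -⟩ := cell_powers q k p h3 hk3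
  have hkey : 64 * 2 ^ q * (d * (d + 1) * (d + 2)) * q ^ 3 ≤ 3 * d * p ^ 3 := by
    have h1 : (d + 1) * (d + 2) ≤ k ^ 2 * k ^ 2 := Nat.mul_le_mul (by omega) hk
    calc 64 * 2 ^ q * (d * (d + 1) * (d + 2)) * q ^ 3 = d * (64 * 2 ^ q * ((d + 1) * (d + 2)) * q ^ 3) := by ring
      _ ≤ d * (64 * 2 ^ q * (k ^ 2 * k ^ 2) * q ^ 3) := by gcongr
      _ = d * (64 * k * (q ^ 3 * k ^ 3 * 2 ^ q)) := by ring
      _ ≤ d * (81 * 2 ^ ((q + 1) / 2) * (q ^ 3 * k ^ 3 * 2 ^ q)) := by gcongr; omega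
      _ = 3 * d * (27 * q ^ 3 * k ^ 3 * 2 ^ q * 2 ^ ((q + 1) / 2)) := by ring
      _ ≤ 3 * d * p ^ 3 := Nat.mul_le_mul_left _ hp3
  have hp0 : 0 < p := lt_of_lt_of_le (Nat.mul_pos (Nat.mul_pos (by norm_num) (by omega)) (by omega)) h2
  have hpos : 0 < p ^ 3 := pow_pos hp0 3
  apply Nat.le_of_mul_le_mul_right _ hpos
  calc 32 * 2 ^ q * (d * (d + 1) * (d + 2)) * (p + d).choose (q - 3) * p ^ 3
      ≤ 32 * 2 ^ q * (d * (d + 1) * (d + 2)) * (2 * (p + q).choose (q - 3)) * p ^ 3 := by gcongr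
    _ = 64 * 2 ^ q * (d * (d + 1) * (d + 2)) * (p ^ 3 * (p + q).choose (q - 3)) := by ring
    _ ≤ 64 * 2 ^ q * (d * (d + 1) * (d + 2)) * (q ^ 3 * (p + q).choose q) := Nat.mul_le_mul_left _ hdown
    _ = (64 * 2 ^ q * (d * (d + 1) * (d + 2)) * q ^ 3) * (p + q).choose q := by ring
    _ ≤ (3 * d * p ^ 3) * (p + q).choose q := Nat.mul_le_mul_right _ hkey
    _ = 3 * d * (p + q).choose q * p ^ 3 := by ring

/-- **(S5) per corank**: `96·2^q·C(2d+2q−2, 4)·C(2d+2q−6+(p+d), q−4) ≤ 35·d·C(p+q, q)`. -/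
theorem small_five_cell (q d p k : ℕ) (hq : 8 ≤ q) (hd1 : q + 1 ≤ d) (h2 : 3 * (q + 5) * d ≤ p)
    (hk : d + 2 ≤ k ^ 2) (hk3 : 3 * k ^ 2 ≤ 2 ^ q) (h3 : 3 * q * k * 2 ^ ((q + 1) / 2) ≤ p) :
    96 * 2 ^ q * (2 * d + 2 * q - 2).choose 4 * (2 * d + 2 * q - 6 + (p + d)).choose (q - 4) ≤
      35 * d * (p + q).choose q := by
  obtain ⟨-, -, h8, h4⟩ := cell_ratios q d p hq hd1 h2
  obtain ⟨-, -, hdown⟩ := levels_down2 p q (by omega)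
  obtain ⟨-, -, hp4⟩ := cell_powers q k p h3 hk3
  have hkey : 196608 * 2 ^ q * d ^ 4 * q ^ 4 ≤ 840 * d * p ^ 4 := by
    have h1 : d ^ 3 ≤ (k ^ 2) ^ 3 := Nat.pow_le_pow_left (by omega) 3
    calc 196608 * 2 ^ q * d ^ 4 * q ^ 4 = d * (196608 * 2 ^ q * d ^ 3 * q ^ 4) := by ring
      _ ≤ d * (196608 * 2 ^ q * (k ^ 2) ^ 3 * q ^ 4) := by gcongr
      _ = d * (65536 * (3 * k ^ 2) * (2 ^ q * q ^ 4 * k ^ 4)) := by ring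
      _ ≤ d * (65536 * 2 ^ q * (2 ^ q * q ^ 4 * k ^ 4)) := by gcongr
      _ ≤ d * (68040 * 2 ^ q * (2 ^ q * q ^ 4 * k ^ 4)) := by gcongr; norm_num
      _ = 840 * d * (81 * q ^ 4 * k ^ 4 * (2 ^ q) ^ 2) := by ring
      _ ≤ 840 * d * p ^ 4 := Nat.mul_le_mul_left _ hp4
  have hp0 : 0 < p := lt_of_lt_of_le (Nat.mul_pos (Nat.mul_pos (by norm_num) (by omega)) (by omega)) h2
  have hpos : 0 < 24 * p ^ 4 := by have := pow_pos hp0 4; omega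
  apply Nat.le_of_mul_le_mul_right _ hpos
  calc 96 * 2 ^ q * (2 * d + 2 * q - 2).choose 4 * (2 * d + 2 * q - 6 + (p + d)).choose (q - 4) * (24 * p ^ 4)
      = 96 * 2 ^ q * (24 * (2 * d + 2 * q - 2).choose 4) * (2 * d + 2 * q - 6 + (p + d)).choose (q - 4) * p ^ 4 := by
        ring
    _ ≤ 96 * 2 ^ q * (256 * d ^ 4) * (8 * (p + q).choose (q - 4)) * p ^ 4 := by gcongr
    _ = 196608 * 2 ^ q * d ^ 4 * (p ^ 4 * (p + q).choose (q - 4)) := by ring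
    _ ≤ 196608 * 2 ^ q * d ^ 4 * (q ^ 4 * (p + q).choose q) := Nat.mul_le_mul_left _ hdown
    _ = (196608 * 2 ^ q * d ^ 4 * q ^ 4) * (p + q).choose q := by ring
    _ ≤ (840 * d * p ^ 4) * (p + q).choose q := Nat.mul_le_mul_right _ hkey
    _ = 35 * d * (p + q).choose q * (24 * p ^ 4) := by ring

/-- **(B) per corank**: `16·2^q·C((q+3)d + 2q − 2, q) ≤ d·C(p+q, q)` for `p ≥ 3(q+5)d` (`16·2^q ≤ 3^q`). -/
theorem big_cell (q d p : ℕ) (hq : 8 ≤ q) (hd1 : q + 1 ≤ d) (h2 : 3 * (q + 5) * d ≤ p) :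
    16 * 2 ^ q * ((q + 3) * d + 2 * q - 2).choose q ≤ d * (p + q).choose q := by
  have hY : (q + 3) * d + 2 * q - 2 ≤ (q + 5) * d := by
    calc (q + 3) * d + 2 * q - 2 ≤ (q + 3) * d + 2 * q := Nat.sub_le _ _
      _ ≤ (q + 3) * d + 2 * d := by omega
      _ = (q + 5) * d := by ring
  have h16 := sixteen_two_pow_le_three_pow q (by omega)
  have hmain : 16 * 2 ^ q * ((q + 5) * d) ^ q ≤ d * (p + 1) ^ q := by
    have hd1' : 1 ≤ d := by omega
    calc 16 * 2 ^ q * ((q + 5) * d) ^ q ≤ 3 ^ q * ((q + 5) * d) ^ q := Nat.mul_le_mul_right _ h16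
      _ = 1 * (3 * ((q + 5) * d)) ^ q := by rw [mul_pow 3, one_mul]
      _ ≤ d * (3 * ((q + 5) * d)) ^ q := Nat.mul_le_mul_right _ hd1'
      _ ≤ d * (p + 1) ^ q := Nat.mul_le_mul_left _ (Nat.pow_le_pow_left (by nlinarith) q)
  have hfac : 0 < q.factorial := Nat.factorial_pos q
  apply Nat.le_of_mul_le_mul_left _ hfac
  calc q.factorial * (16 * 2 ^ q * ((q + 3) * d + 2 * q - 2).choose q)
      = 16 * 2 ^ q * (q.factorial * ((q + 3) * d + 2 * q - 2).choose q) := by ring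
    _ ≤ 16 * 2 ^ q * ((q + 3) * d + 2 * q - 2) ^ q := Nat.mul_le_mul_left _ (factorial_mul_choose_le_pow _ _)
    _ ≤ 16 * 2 ^ q * ((q + 5) * d) ^ q := Nat.mul_le_mul_left _ (Nat.pow_le_pow_left hY q)
    _ ≤ d * (p + 1) ^ q := hmain
    _ ≤ d * (q.factorial * (p + q).choose q) := Nat.mul_le_mul_left _ (pow_le_factorial_mul_choose p q)
    _ = q.factorial * (d * (p + q).choose q) := by ring

/-- **THE ASSEMBLED `(P_d)` PER CORANK** (in `ℚ`): at level `q ≥ 8`, corank `d ≥ q + 2`, `p ≥ Tcell2 q d k`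
(`d + 2 ≤ k²`, `3k² ≤ 2^q`), both weights at their cap (`W·d ≤ 2^d`):
`8·(C(p+d, q) + W_s·A + W_b·B) ≤ 7·2^{d−q}·C(p+q, q)`. -/
theorem poly_cells (q d p k : ℕ) (hq : 8 ≤ q) (hd1 : q + 2 ≤ d)
    (hk : d + 2 ≤ k ^ 2) (hk3 : 3 * k ^ 2 ≤ 2 ^ q) (hp : Tcell2 q d k ≤ p)
    (A B : ℕ) (Ws Wb : ℚ) (hWs : Ws * d ≤ 2 ^ d) (hWb : Wb * d ≤ 2 ^ d)
    (hA : 6 * A ≤ 3 * (d * (d + 1)) * (p + d).choose (q - 2) + 2 * (d * (d + 1) * (d + 2)) * (p + d).choose (q - 3) +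
      6 * ((2 * d + 2 * q - 2).choose 4 * (2 * d + 2 * q - 6 + (p + d)).choose (q - 4)))
    (hB : B ≤ ((q + 3) * d + 2 * q - 2).choose q) :
    8 * (((p + d).choose q : ℚ) + Ws * A + Wb * B) ≤ 7 * 2 ^ (d - q) * ((p + q).choose q : ℚ) := by
  obtain ⟨h1, h2, h3, hp2⟩ := Tcell2_facts q d k p hp
  set C := (p + q).choose q with hC
  set A6 := 3 * (d * (d + 1)) * (p + d).choose (q - 2) + 2 * (d * (d + 1) * (d + 2)) * (p + d).choose (q - 3) +
      6 * ((2 * d + 2 * q - 2).choose 4 * (2 * d + 2 * q - 6 + (p + d)).choose (q - 4)) with hA6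
  have hd0 : 0 < d := by omega
  have hC1 := c1_cell q d p hq (by omega) h1 h2
  have hC1q : 64 * ((p + d).choose q : ℚ) ≤ (64 + 2 ^ (d - q)) * (C : ℚ) := by rw [hC]; exact_mod_cast hC1
  have hBn : 16 * 2 ^ q * B ≤ 1 * d * 2 ^ 0 * C :=
    (Nat.mul_le_mul_left _ hB).trans (by rw [one_mul, pow_zero, mul_one]; exact big_cell q d p hq (by omega) h2)
  have hbig := weight_bound2 q d d 0 16 1 B B C Wb hWb hd0 le_rfl hBn (by omega) (by omega)
  push_cast at hbig
  have hs3 := small_three_cell q d p k hq (by omega) h2 hk hp2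
  have hs4 := small_four_cell q d p k hq (by omega) h2 hk hk3 h3
  have hs5 := small_five_cell q d p k hq (by omega) h2 hk hk3 h3
  have hS : 4 * 2 ^ q * A6 ≤ 13 * d * 2 ^ 0 * C := by
    rw [pow_zero, mul_one]
    have : 16 * 2 ^ q * A6 ≤ 52 * d * C := by
      calc 16 * 2 ^ q * A6 = 2 * (24 * 2 ^ q * (d * (d + 1)) * (p + d).choose (q - 2)) +
            32 * 2 ^ q * (d * (d + 1) * (d + 2)) * (p + d).choose (q - 3) +
            96 * 2 ^ q * (2 * d + 2 * q - 2).choose 4 * (2 * d + 2 * q - 6 + (p + d)).choose (q - 4) := by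
            rw [hA6]; ring
        _ ≤ 2 * (7 * d * C) + 3 * d * C + 35 * d * C := by gcongr
        _ = 52 * d * C := by ring
    have h4 : 4 * (4 * 2 ^ q * A6) ≤ 4 * (13 * d * C) := by
      calc 4 * (4 * 2 ^ q * A6) = 16 * 2 ^ q * A6 := by ring
        _ ≤ 52 * d * C := this
        _ = 4 * (13 * d * C) := by ring
    exact Nat.le_of_mul_le_mul_left h4 (by norm_num)
  have hsmall := weight_bound2 q d d 0 4 13 A6 (6 * A) C Ws hWs hd0 hA hS (by omega) (by omega)
  push_cast at hsmall
  have hC0 : (0 : ℚ) ≤ C := Nat.cast_nonneg _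
  have hdq4 : (4 : ℚ) ≤ 2 ^ (d - q) := by
    calc (4 : ℚ) = 2 ^ 2 := by norm_num
      _ ≤ 2 ^ (d - q) := pow_le_pow_right₀ (by norm_num) (by omega)
  have := mul_le_mul_of_nonneg_right hdq4 hC0
  nlinarith

end Explicit

end ThmN

end PercRepro
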